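import Summits.MatrixMultiplication.OmegaCensus.DominoZ5LineTable9A
import Summits.MatrixMultiplication.OmegaCensus.DominoZ5LineTable9B
import Summits.MatrixMultiplication.OmegaCensus.DominoZ5LineRows9
import Summits.MatrixMultiplication.OmegaCensus.ThreeSetZ5Z5PlaneCertificate
import Summits.MatrixMultiplication.OmegaCensus.ThreeSetZ5Z5Cover44Defs
import HarnessLib

/-!
# Domino line certificates over `ZMod 5` for `|X| = 9` at line fibre size `65`: table checks and row certificates

ω-census `pub-omega`, family (b3), seat pub-omega-group gen 37.  Framing: lottery ticket; floor = certified bounds/negative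
ranges.  VALUE: the kernel-checked LINE stage of the census cell `(1,9,12)@325` of `ℤ₅ × ℤ₆₅` (design
`HOME/pub-omega-group-g37/DESIGN-1-9-12.md`): of the `3 575` domino line data `(F, s)` (`F` a count vector of size `9` on `ZMod 5`, `s` a hole
value) exactly `160` admit a solution `G ∈ ℕ⁵` of the line identity `Σ_u M(τ,u)·G(u) + [s = τ] = 65`, `M(τ,u) = F(τ−u) + F(u−τ) + F(τ+u)`
(the three-set identity with `W`-image `[1,0,0,0,0]`); the other `3 415` are excluded here — `3 075` by the modular certificates of
`DominoZ5LineTable9A/B.lean` (`ann19`, `exclOK`; order-free) and `340` (all with a NONSINGULAR line matrix) by one integer row `y` of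
`N·M⁻¹` at fibre size `65`: `N·G(u₀) = 65·Σy − y(s)` is negative or not divisible by `N` (`lineRowOK`, `exrow19`); NOT progress on ω.
* `w0vec`, `table19`, `ann19`; `lineRowOK`, `lineRowRefuteOK`, `false_of_lineRowRefuteOK`; `exrow19_ok` (data `DominoZ5LineRows9.lean`);
* `certAt19 σ j F` — the per-hole certified-direction predicate; **`false_of_certAt19`** — it contradicts the line identity at hole
  value `pv 5 j σ` and fibre size `65`.
-/

namespace Summit.MatrixMultiplication.OmegaCensus

namespace Z5Z5ThreeSet

open Finset ZpZpDomino

/-- The `W`-image of a domino (`W = {0}`) in every direction: the count vector `[1,0,0,0,0]`. [folklore] -/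
def w0vec : List ℕ := [1, 0, 0, 0, 0]

/-- The full certified domino line table for `|X| = 9`. [folklore] -/
def table19 : List (List ℕ × List (ℕ × List ℕ)) := table19A ++ table19B

set_option maxRecDepth 100000 in
/-- **Table check**: every certificate annihilates its line matrix. [folklore] -/
theorem ann19 : (table19.all fun e => annOKNat w0vec e.1 e.2) = true := by decide +kernel

/-! ## Integer row certificates for the line identity at fibre size `65` -/

/-- Row certificate check for the `5 × 5` line matrix: `Σ_τ y(τ)·M(τ,u) = N·[u = u₀]` for all `u < 5`. [folklore] -/
def lineRowOK (F : List ℕ) (y : List ℤ) (N u₀ : ℕ) : Bool :=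
  (List.range 5).all fun u =>
    ((List.range 5).map fun τ => y.getD τ 0 * (lineMat3Nat w0vec F τ u : ℤ)).sum == (if u = u₀ then (N : ℤ) else 0)

/-- The paired right-hand side `65·Σy − y(s)`. [folklore] -/
def lineRowRHS (y : List ℤ) (s : ℕ) : ℤ := 65 * ((List.range 5).map fun τ => y.getD τ 0).sum - y.getD s 0

/-- Line refutation certificate `(u₀, N, S, y + S)` (row shifted into `ℕ`): `u₀ < 5`, `lineRowOK`, and `65·Σy − y(s)` negative or not
divisible by `N`. [folklore] -/
def lineRowRefuteOK (F : List ℕ) (s : ℕ) (c : ℕ × ℕ × ℕ × List ℕ) : Bool :=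
  decide (c.1 < 5) && lineRowOK F (zrow c.2.2.1 c.2.2.2) c.2.1 c.1 &&
    (decide (lineRowRHS (zrow c.2.2.1 c.2.2.2) s < 0) || lineRowRHS (zrow c.2.2.1 c.2.2.2) s % (c.2.1 : ℤ) != 0)

/-- **Pairing the line identity with a certified row**: `N·G(u₀) = 65·Σy − y(s)`. [folklore] -/
theorem mul_eq_of_lineRowOK {F : List ℕ} {y : List ℤ} {N u₀ : ℕ} (hrow : lineRowOK F y N u₀ = true) (hu₀ : u₀ < 5)
    (G : ZMod 5 → ℕ) {s : ℕ} (hs : s < 5)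
    (hid : ∀ τ : ZMod 5, (∑ u : ZMod 5, lineMat3 (vecFn w0vec) (vecFn F) τ u * G u) +
      (if ((s : ℕ) : ZMod 5) = τ then 1 else 0) = 65) :
    (N : ℤ) * (G ((u₀ : ℕ) : ZMod 5) : ℤ) = lineRowRHS y s := by
  simp only [lineRowOK, List.all_eq_true, List.mem_range, beq_iff_eq] at hrow
  have hcol : ∀ u : ZMod 5, ∑ τ : ZMod 5, y.getD τ.val 0 * (lineMat3 (vecFn w0vec) (vecFn F) τ u : ℤ) =
      if u = ((u₀ : ℕ) : ZMod 5) then (N : ℤ) else 0 := by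
    intro u
    have h1 := hrow u.val (ZMod.val_lt u)
    rw [sum_range5_eq_sum_zmod5 (fun τ => y.getD τ 0 * (lineMat3Nat w0vec F τ u.val : ℤ))] at h1
    have e : ∑ τ : ZMod 5, y.getD τ.val 0 * (lineMat3 (vecFn w0vec) (vecFn F) τ u : ℤ) =
        ∑ τ : ZMod 5, y.getD τ.val 0 * (lineMat3Nat w0vec F τ.val u.val : ℤ) :=
      sum_congr rfl fun τ _ => by rw [lineMat3_vecFn]
    rw [e, h1]
    by_cases hu : u = ((u₀ : ℕ) : ZMod 5)
    · rw [if_pos hu, if_pos (by rw [hu, ZMod.val_natCast, Nat.mod_eq_of_lt hu₀])]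
    · rw [if_neg hu, if_neg (fun h' => hu (by rw [← h', ZMod.natCast_zmod_val]))]
  have hpair : ∑ τ : ZMod 5, y.getD τ.val 0 * (((∑ u : ZMod 5, lineMat3 (vecFn w0vec) (vecFn F) τ u * G u) +
      (if ((s : ℕ) : ZMod 5) = τ then 1 else 0) : ℕ) : ℤ) = ∑ τ : ZMod 5, y.getD τ.val 0 * (65 : ℤ) :=
    sum_congr rfl fun τ _ => by rw [hid τ]; rfl
  have lhs : ∑ τ : ZMod 5, y.getD τ.val 0 * (((∑ u : ZMod 5, lineMat3 (vecFn w0vec) (vecFn F) τ u * G u) +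
      (if ((s : ℕ) : ZMod 5) = τ then 1 else 0) : ℕ) : ℤ) =
      (∑ u : ZMod 5, (G u : ℤ) * ∑ τ : ZMod 5, y.getD τ.val 0 * (lineMat3 (vecFn w0vec) (vecFn F) τ u : ℤ)) +
        y.getD (((s : ℕ) : ZMod 5)).val 0 := by
    have e : ∀ τ : ZMod 5, y.getD τ.val 0 * (((∑ u : ZMod 5, lineMat3 (vecFn w0vec) (vecFn F) τ u * G u) +
        (if ((s : ℕ) : ZMod 5) = τ then 1 else 0) : ℕ) : ℤ) =
        (∑ u : ZMod 5, y.getD τ.val 0 * ((lineMat3 (vecFn w0vec) (vecFn F) τ u : ℤ) * (G u : ℤ))) +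
          (if ((s : ℕ) : ZMod 5) = τ then y.getD τ.val 0 else 0) := by
      intro τ
      push_cast
      rw [mul_add, mul_sum]
      congr 1
      split_ifs <;> simp
    rw [sum_congr rfl fun τ _ => e τ, sum_add_distrib, sum_ite_eq, if_pos (mem_univ _), sum_comm]
    congr 1
    refine sum_congr rfl fun u _ => ?_
    rw [mul_sum]
    exact sum_congr rfl fun τ _ => by ring
  rw [lhs] at hpair
  simp only [hcol, mul_ite, mul_zero, sum_ite_eq', mem_univ, if_true] at hpair
  rw [ZMod.val_natCast, Nat.mod_eq_of_lt hs] at hpair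
  have hrhs : ∑ τ : ZMod 5, y.getD τ.val 0 * (65 : ℤ) = 65 * ((List.range 5).map fun τ => y.getD τ 0).sum := by
    rw [← sum_mul, mul_comm, ← sum_range5_eq_sum_zmod5 (fun τ => y.getD τ 0)]
  rw [hrhs] at hpair
  unfold lineRowRHS
  linear_combination hpair

/-- **Soundness of the line row certificate**: no `G` satisfies the domino line identity for `F` at hole value `s`, fibre size `65`.
[folklore] -/
theorem false_of_lineRowRefuteOK {F : List ℕ} {s : ℕ} (hs : s < 5) {c : ℕ × ℕ × ℕ × List ℕ} (hc : lineRowRefuteOK F s c = true)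
    (G : ZMod 5 → ℕ)
    (hid : ∀ τ : ZMod 5, (∑ u : ZMod 5, lineMat3 (vecFn w0vec) (vecFn F) τ u * G u) +
      (if ((s : ℕ) : ZMod 5) = τ then 1 else 0) = 65) : False := by
  rw [lineRowRefuteOK, Bool.and_eq_true, Bool.and_eq_true, Bool.or_eq_true, decide_eq_true_eq, decide_eq_true_eq, bne_iff_ne,
    ne_eq] at hc
  obtain ⟨⟨hu₀, hrow⟩, hbad⟩ := hc
  have key := mul_eq_of_lineRowOK hrow hu₀ G hs hid
  rcases hbad with hneg | hdiv
  · have : (0 : ℤ) ≤ (c.2.1 : ℤ) * (G ((c.1 : ℕ) : ZMod 5) : ℤ) := by positivity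
    linarith
  · exact hdiv (by rw [← key, Int.mul_emod_right])

/-- **All row certificates pass** (one kernel computation). [folklore] -/
theorem exrow19_ok : (exrow19.all fun e => decide (e.2.1 < 5) && lineRowRefuteOK e.1 e.2.1 e.2.2) = true := by decide +kernel

/-- **Per-hole certified-direction predicate** for the domino line stage: a table certificate excluding the hole value `pv 5 j σ`, or a
row certificate for `(F, pv 5 j σ)`. [folklore] -/
def certAt19 (σ j : ℕ) (F : List ℕ) : Bool :=
  (table19.any fun e => e.1 == F && exclOK e.2 (pv 5 j σ)) ||
    (exrow19.any fun e => e.1 == F && e.2.1 == pv 5 j σ && lineRowRefuteOK F (pv 5 j σ) e.2.2)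

/-- **Soundness of `certAt19`**: no `G : ZMod 5 → ℕ` satisfies the domino line identity at hole value `pv 5 j σ`, fibre size `65`.
[folklore] -/
theorem false_of_certAt19 {σ j : ℕ} {F : List ℕ} (h : certAt19 σ j F = true) (G : ZMod 5 → ℕ)
    (hid : ∀ τ : ZMod 5, (∑ u : ZMod 5, lineMat3 (vecFn w0vec) (vecFn F) τ u * G u) +
      (if ((pv 5 j σ : ℕ) : ZMod 5) = τ then 1 else 0) = 65) : False := by
  rw [certAt19, Bool.or_eq_true] at h
  rcases h with h | h
  · rw [List.any_eq_true] at h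
    obtain ⟨e, he, h'⟩ := h
    rw [Bool.and_eq_true, beq_iff_eq] at h'
    obtain ⟨h1, h2⟩ := h'
    have ha := List.all_eq_true.1 ann19 e he
    rw [h1] at ha
    exact lineCert3At_sound (lineCert3At_of_nat (pv_lt 5 j σ) ha h2) G 65 hid
  · rw [List.any_eq_true] at h
    obtain ⟨e, -, h'⟩ := h
    rw [Bool.and_eq_true, Bool.and_eq_true, beq_iff_eq, beq_iff_eq] at h'
    obtain ⟨⟨-, -⟩, h3⟩ := h'
    exact false_of_lineRowRefuteOK (pv_lt 5 j σ) h3 G hid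

end Z5Z5ThreeSet

end Summit.MatrixMultiplication.OmegaCensus
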